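import Summits.ABC.IUTFork.Joshi.TestTensorPacketsStrictMovesCriterion
import HarnessLib

/-!
# R-J row Y-14 over the free-Ism line-shell family, II: SUFFICIENCY and THE CRITERION
# («some Y-14 dictionary reaches the q-pilot» ⟺ `−3 ∈ M⁺(I)`, the SUBMONOID of `ℤ` generated by the valuations of Ism)

TEST file (D-0012; R14 `Joshi/Test*.lean`; six small model-data definitions, NO `Prop` fact, no `sorry`) of the abc-iut cell, D-0079 sub-cell R-J
«JOSHI Y-DISCHARGE CENSUS», row **Y-14** of `plan/E/R-J/Y-CENSUS.tsv` (rung LADDER-ABC:A2.RESCUE.J; seat abc-iut-E-t20, lineage T-20 = K. Joshi,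
*Construction of Arithmetic Teichmüller Spaces III*, arXiv:2401.13508 **v4** = `Joshi2024ATS3`, §9.4 «Mochizuki's tensor-packet codomain»). Part II
of two; part I = `TestTensorPacketsStrictMovesCriterion.lean` (necessity: a Y-14 route to the q-pilot forces `−3 ∈ M⁺(I)`; the isometric and
nonnegative-drift obstructions). Vocabulary as there: reading `Ism := I ∋ 1` of E-t58's free-Ism shells `IsmPartial.ismShells I` (p438400),
setting `ismSetting`, operator `scalRegion` (E-t41), q-datum `qDatum`; `G(I)` / `M⁺(I)` = the additive subgroup / submonoid of `ℤ` generated by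
`{v_p(g 1) : g ∈ I}`. TAKES NO SIDE on [IUTchIII] Cor. 3.12, on Joshi's claims or on Mochizuki's report on them; typed ≠ proved ≠ endorsed;
a model EXHIBITS satisfiability of typed hypotheses, nothing more; the cell locates / conditionally verifies — NO abc claim.

## What is proved here

* §3 SUFFICIENCY `routeDictionary`: for EVERY reading `I` and every list `ms` of elements of `I`, the TAIL realisations (identity on the
  carriers of `y′_0, y′_1`, the element `m ∈ I` on the carrier of `y′_2`) along `z_Θ = (y′_0, y′_1, y′_2)` ([J-III] §9.4.4 p.102 l.22–28) are
  §9.4 strict moves with (Ind)-local components (`tailMove`; at the labels `0, 1` they fix every ball, at label `2` they shift by `v_p(m 1)`);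
  the dictionary (abc-iut-E-plan's `Joshi.Dictionary`, rows D-02/D-03/D-04 — E-t41's `scalDictionary` p433757 with MANY moves) with points the
  accumulated transports, moves the elements of `I` so realised, base `1` (datum `Ψ_v`), standard point the accumulated transport of `ms`
  satisfies Y-14 (`RealisedByStrictMoves` by `rfl`, `LocalIsosInInd`) ∧ `BaseIsThetaPilot` ∧ `MovesAreInd` BY THE D-09 ROUTE
  (`movesAreInd_of_strictMoves`, p430617) ∧ `DatumEquivariant` ∧ `StdReachable`; and Y₂ `StandardPointIsQPilot` (∧ its size form) as soon as
  `Σ_{m ∈ ms} v_p(m 1) = −3` — non-degenerately (moves inhabited, data of base and standard point differ, ¬`LogvolInvariant`); the X-01 glue then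
  returns S (`routeDictionary_props`).
* §4 **THE CRITERION** `strictMovesRoute_iff`: «some `(𝔇, 𝔗, G, z)` over `ismSetting p I` has Y-14 ∧ the three other X-01 hypotheses ∧ Y₂»
  ⟺ `−3 = 1 − 2² ∈ M⁺(I)` (necessity = part I). COROLLARIES: the route implies S (`pilotKummerIndRelated_of_mem_closure`; `M⁺ ≤ G`) and
  ¬`LogvolInvariant` (`strictMovesRoute_not_logvolInvariant`: A1's NON-ISOMETRIC horn is NECESSARY). The readings — isometric (route and S both
  dead), closed under inverses (route ⟺ S, `M⁺ = G`), `I = {id, x ↦ p³·x}` (S HOLDS, route DEAD: `M⁺ = 3ℕ ∌ −3 ∈ 3ℤ = G`) — are recorded in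
  `TestTensorPacketsStrictMovesReadings.lean`.
LOCATED, NOT ADJUDICATED: row Y-14 is decided by ONE arithmetic datum of the reading — whether the valuations of Ism generate `1 − 2² = −3` as a
MONOID —, sandwiched `−3 ∈ M⁺(I) ⟹ −3 ∈ G(I) (⟺ S) ⟹ v_p(I) ≠ 0 (⟺ ¬LogvolInvariant)`, both implications strict. Which Ism print intends
([IUTchII] Ex. 1.8 (iv) / [IUTchIII] Prop. 1.2 (vi) «Ism» ↔ [J-III] §8.11.1 p.91 l.44–46 «ℚ_p-linear isomorphisms σ») is attach point A1
(E-LOCATION §L1) and is NOT decided here. [claim: Joshi2024ATS3, status: disputed] [claim: Mochizuki2012, status: disputed]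
[cite: ScholzeStix2018, §2.2 pp. 9–10]
-/

noncomputable section

open Set

namespace Summit.ABC.IUTFork.Joshi

open Thm311 Cor312 Cor312Vol Cor312.Checks Cor312.IdentifiedNonVacuity Cor312Vol.NaiveWitness Cor312Vol.PinnedWitness
  Literature.IUT.LogThetaLattice IsmScaling IsmPartial

/-! ## 3. SUFFICIENCY: the tail realisations `(id, id, m)` along `z_Θ` and the route dictionary -/

section Sufficiency

variable (p : ℕ) [hp : Fact p.Prime] (I : Set (ℚ ≃ₗ[ℚ] ℚ)) (hI : LinearEquiv.refl ℚ ℚ ∈ I)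

/-- The per-position units of the TAIL realisation of a line automorphism `m`: `1` at the positions `0, 1` of `z_Θ = (y′_0, y′_1, y′_2)`, the
scalar `m 1` at position `2`. MODEL DATA. [folklore] -/
def tailUnits (m : ℚ ≃ₗ[ℚ] ℚ) (a : ℕ) : ℚˣ :=
  if a = 2 then Units.mk0 (m 1) (Repair.CandMochizuki7.rat_linearEquiv_one_ne_zero m) else 1

/-- The tail units read at the entries `y′_a` of `z_Θ` (labels). MODEL DATA. [folklore] -/
def tailUnitsL (m : ℚ ≃ₗ[ℚ] ℚ) (a : toyIndex.Label) : ℚˣ := tailUnits m a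

/-- **The tail realisation** `G(y′_a)_v := (x ↦ tailUnits m a · x)`: the identity on the carriers of `y′_0, y′_1`, the automorphism `m` on the
carrier of `y′_2` (p433729's `scalarMoves`). MODEL DATA. [folklore] -/
def tailG (m : ℚ ≃ₗ[ℚ] ℚ) : toyIndex.Label → toyIndex.V → (ℚ ≃ₗ[ℚ] ℚ) := scalarMoves (tailUnitsL m)

/-- **The tail strict move** `T_m` := the §9.4 strict move along `z_Θ` (the label datum of p433729, `z_Θ = id`) induced by `tailG m`, as a
packet-automorphism family of `ismShells I`. MODEL DATA. [folklore] -/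
def tailMove (m : ℚ ≃ₗ[ℚ] ℚ) : (ismShells I hI).PacketAut := (labelDatum toyIndex).strictMove (ismShells I hI) (tailG m) id

omit hp in
include hI in
/-- The components of `tailG m` lie in `I` as soon as `m ∈ I` (the identity is in `I`). [folklore] -/
theorem tailG_mem {m : ℚ ≃ₗ[ℚ] ℚ} (hm : m ∈ I) (a : toyIndex.Label) (w : toyIndex.V) : tailG m a w ∈ I := by
  show LinearEquiv.smulOfUnit (tailUnitsL m a) ∈ I
  unfold tailUnitsL tailUnits
  split_ifs
  · rw [smulOfUnit_mk0_eq]; exact hm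
  · rw [smulOfUnit_one_eq]; exact hI

omit hp in
/-- The product of the tail units over the positions `< n`, `n ≤ 2`, is `1`. [folklore] -/
theorem prod_range_tailUnits_of_le_two (m : ℚ ≃ₗ[ℚ] ℚ) {n : ℕ} (hn : n ≤ 2) : ∏ i ∈ Finset.range n, (tailUnits m i : ℚ) = 1 :=
  Finset.prod_eq_one fun i hi => by
    have hi2 : i ≠ 2 := by have := Finset.mem_range.1 hi; omega
    simp [tailUnits, hi2]

omit hp in
/-- The cumulative scalar of the tail move at label `j` is `∏_{i ≤ j} tailUnits m i`. [folklore] -/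
theorem prod_tailUnits (m : ℚ ≃ₗ[ℚ] ℚ) (j : toyIndex.Label) :
    (∏ a : toyIndex.Caps j, (tailUnitsL m ((labelDatum toyIndex).capsEntry id j a) : ℚ)) =
      ∏ i ∈ Finset.range ((j : ℕ) + 1), (tailUnits m i : ℚ) := by
  have h1 : (∏ a : toyIndex.Caps j, (tailUnitsL m ((labelDatum toyIndex).capsEntry id j a) : ℚ)) =
      ∏ a : Fin ((j : ℕ) + 1), (tailUnits m a : ℚ) := rfl
  rw [h1, Fin.prod_univ_eq_prod_range (fun i => (tailUnits m i : ℚ)) ((j : ℕ) + 1)]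

/-- The tail move carries `B_k` onto `B_{k + v_p(∏_{i ≤ j} tailUnits m i)}` at label `j`. [folklore] -/
theorem image_pBall_tailMove (m : ℚ ≃ₗ[ℚ] ℚ) (j : toyIndex.Label) (vQ : toyIndex.VQ) (k : ℤ) :
    tailMove I hI m j vQ '' pBall p j vQ k = pBall p j vQ (k + padicValRat p (∏ i ∈ Finset.range ((j : ℕ) + 1), (tailUnits m i : ℚ))) := by
  rw [← prod_tailUnits]
  exact image_pBall_strictMove_scalar signs I (Set.mem_insert _ _) hI p (labelDatum toyIndex) (tailUnitsL m) id j vQ k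

/-- **At the labels `0, 1` the tail move FIXES every ball** … [folklore] -/
theorem image_pBall_tailMove_of_ne_two (m : ℚ ≃ₗ[ℚ] ℚ) {j : toyIndex.Label} (hj : (j : ℕ) ≠ 2) (vQ : toyIndex.VQ) (k : ℤ) :
    tailMove I hI m j vQ '' pBall p j vQ k = pBall p j vQ k := by
  have h3 : (j : ℕ) < 3 := j.2
  rw [image_pBall_tailMove, prod_range_tailUnits_of_le_two m (by omega), padicValRat.one, add_zero]

/-- **… and at label `2` it shifts by `v_p(m 1)`**: `T_m(B_k) = B_{k + v_p(m 1)}`. [folklore] -/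
theorem image_pBall_tailMove_two (m : ℚ ≃ₗ[ℚ] ℚ) (vQ : toyIndex.VQ) (k : ℤ) :
    tailMove I hI m 2 vQ '' pBall p 2 vQ k = pBall p 2 vQ (k + padicValRat p (m 1)) := by
  have h2 : ((2 : toyIndex.Label) : ℕ) = 2 := rfl
  have hu : ((tailUnits m 2 : ℚˣ) : ℚ) = m 1 := by simp [tailUnits]
  rw [image_pBall_tailMove, h2, Finset.prod_range_succ, prod_range_tailUnits_of_le_two m le_rfl, one_mul, hu]

omit hp in
/-- Composition of packet-automorphism families acts on `∏_{j ∈ 𝔽_l^⋆}` by composition. [folklore] -/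
theorem route_starAut_mul_image (Φ Ψ : signShells.PacketAut) (v : toyIndex.V) (X : Set (signShells.StarPacket v)) :
    signShells.starAut (Φ * Ψ) v '' X = signShells.starAut Φ v '' (signShells.starAut Ψ v '' X) := by
  rw [Set.image_image]
  rfl

omit hp in
/-- A product of packet-automorphism families acts on each packet by composition. [folklore] -/
theorem route_packetAut_mul_image (Φ Ψ : (ismShells I hI).PacketAut) (j : toyIndex.Label) (vQ : toyIndex.VQ)
    (X : Set (signShells.Packet j vQ)) : (Φ * Ψ) j vQ '' X = Φ j vQ '' (Ψ j vQ '' X) := by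
  rw [Set.image_image]
  rfl

omit hp in
/-- The identity family fixes every set. [folklore] -/
theorem route_packetAut_one_image (j : toyIndex.Label) (vQ : toyIndex.VQ) (X : Set (signShells.Packet j vQ)) :
    (1 : (ismShells I hI).PacketAut) j vQ '' X = X := by
  ext x
  exact ⟨fun ⟨y, hy, hyx⟩ => by subst hyx; exact hy, fun hx => ⟨x, hx, rfl⟩⟩

/-- **The accumulated transport of a list of tail moves**: `T_{m_1} ∘ ⋯ ∘ T_{m_n}`. MODEL DATA. [folklore] -/
def routeAut (ms : List {m : ℚ ≃ₗ[ℚ] ℚ // m ∈ I}) : (ismShells I hI).PacketAut :=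
  ms.foldr (fun m Φ => tailMove I hI m.1 * Φ) 1

omit hp in
/-- Unfolding the accumulated transport of `m :: ms`. [folklore] -/
theorem routeAut_cons (m : {m : ℚ ≃ₗ[ℚ] ℚ // m ∈ I}) (ms : List {m : ℚ ≃ₗ[ℚ] ℚ // m ∈ I}) :
    routeAut I hI (m :: ms) = tailMove I hI m.1 * routeAut I hI ms := rfl

/-- The accumulated transport FIXES every ball at the labels `0, 1` … [folklore] -/
theorem image_pBall_routeAut_of_ne_two (ms : List {m : ℚ ≃ₗ[ℚ] ℚ // m ∈ I}) {j : toyIndex.Label} (hj : (j : ℕ) ≠ 2)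
    (vQ : toyIndex.VQ) (k : ℤ) : routeAut I hI ms j vQ '' pBall p j vQ k = pBall p j vQ k := by
  induction ms with
  | nil => exact route_packetAut_one_image I hI j vQ _
  | cons m ms ih => rw [routeAut_cons, route_packetAut_mul_image, ih, image_pBall_tailMove_of_ne_two p I hI m.1 hj]

/-- … and shifts by the TOTAL VALUATION `Σ v_p(m_i 1)` at label `2`. [folklore] -/
theorem image_pBall_routeAut_two (ms : List {m : ℚ ≃ₗ[ℚ] ℚ // m ∈ I}) (vQ : toyIndex.VQ) (k : ℤ) :
    routeAut I hI ms 2 vQ '' pBall p 2 vQ k = pBall p 2 vQ (k + (ms.map fun m => padicValRat p (m.1 1)).sum) := by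
  induction ms generalizing k with
  | nil => rw [List.map_nil, List.sum_nil, add_zero]; exact route_packetAut_one_image I hI 2 vQ _
  | cons m ms ih =>
      rw [routeAut_cons, route_packetAut_mul_image, ih, image_pBall_tailMove_two p I hI m.1, List.map_cons, List.sum_cons]
      congr 1
      ring

/-- **THE ROUTE DICTIONARY of a list `ms` of elements of `I`** (abc-iut-E-plan's `Joshi.Dictionary`, rows D-02/D-03/D-04, instantiated as
abc-iut-E-t41's `scalDictionary` p433757 but with MANY moves and over the free-Ism shells): points = accumulated transports `Φ` (datum
`Φ · Ψ_v`), moves = the elements of `I`, each REALISED by its tail strict move, base `1` (datum `Ψ_v` itself), standard point the accumulated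
transport of `ms`. MODEL DATA. [claim: Joshi2024ATS3, status: disputed] -/
def routeDictionary (ms : List {m : ℚ ≃ₗ[ℚ] ℚ // m ∈ I}) : Dictionary (ismFull p I hI).toLatticeSituation where
  Pt := (ismShells I hI).PacketAut
  Move := {m : ℚ ≃ₗ[ℚ] ℚ // m ∈ I}
  act := fun m Φ => tailMove I hI m.1 * Φ
  base := 1
  std := routeAut I hI ms
  datum := fun Φ v _ => signShells.starAut Φ v '' Psi p v
  real := fun m => tailMove I hI m.1

variable (ms : List {m : ℚ ≃ₗ[ℚ] ℚ // m ∈ I})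

omit hp in
/-- **Y-14, first half: `RealisedByStrictMoves` HOLDS** — along `z_Θ`, by the tail realisations (by `rfl`). [folklore] -/
theorem routeDictionary_realisedByStrictMoves :
    RealisedByStrictMoves (routeDictionary p I hI ms) (labelDatum toyIndex) (fun m => tailG m.1) (fun _ => id) := fun _ => rfl

omit hp in
/-- **Y-14, second half: `LocalIsosInInd` HOLDS** — every component is an element of Ism `= I` (its (Ind2)-disjunct). [folklore] -/
theorem routeDictionary_localIsosInInd : LocalIsosInInd (routeDictionary p I hI ms) (labelDatum toyIndex) (fun m => tailG m.1) :=
  fun m => Or.inr fun a w => tailG_mem I hI m.2 a w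

omit hp in
/-- **`MovesAreInd` HOLDS — BY THE D-09 ROUTE** (`movesAreInd_of_strictMoves`, p430617). [claim: Joshi2024ATS3, status: disputed] -/
theorem routeDictionary_movesAreInd : MovesAreInd (routeDictionary p I hI ms) :=
  movesAreInd_of_strictMoves (routeDictionary p I hI ms) (labelDatum toyIndex) (fun m => tailG m.1) (fun _ => id)
    (routeDictionary_realisedByStrictMoves p I hI ms) (routeDictionary_localIsosInInd p I hI ms)

omit hp in
/-- **`BaseIsThetaPilot` HOLDS**: the base datum is `Ψ_v`. [claim: Joshi2024ATS3, status: disputed] -/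
theorem routeDictionary_baseIsThetaPilot : BaseIsThetaPilot (routeDictionary p I hI ms) (P := ismSetting p I hI) :=
  funext fun v => funext fun _ => Set.ext fun x =>
    ⟨fun ⟨y, hy, hyx⟩ => by subst hyx; exact hy, fun hx => ⟨x, hx, rfl⟩⟩

omit hp in
/-- **`DatumEquivariant` HOLDS** (the datum of `T_m · Φ` is the `T_m`-transport of the datum of `Φ`). [claim: Joshi2024ATS3, status: disputed] -/
theorem routeDictionary_datumEquivariant : DatumEquivariant (routeDictionary p I hI ms) := fun m Φ v _ =>
  route_starAut_mul_image (tailMove I hI m.1) Φ v (Psi p v)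

omit hp in
/-- **`StdReachable` HOLDS**: the standard point is `ms · base` (by `rfl`). [claim: Joshi2024ATS3, status: disputed] -/
theorem routeDictionary_stdReachable : StdReachable (routeDictionary p I hI ms) := ⟨ms, rfl⟩

omit hp in
/-- The `ρ`-region of the standard-point datum is the image of the region of `Ψ_v` under the accumulated transport (E-t41's
equivariance of `scalRegion`). [folklore] -/
theorem routeDictionary_region_std (j : toyIndex.Label) (vQ : toyIndex.VQ) :
    scalRegion p ((routeDictionary p I hI ms).datum (routeDictionary p I hI ms).std) j vQ =
      routeAut I hI ms j vQ '' scalRegion p (fun v _ => Psi p v) j vQ :=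
  scalRegion_equivariant p (routeAut I hI ms) (fun v _ => Psi p v) j vQ

/-- **Y₂ `StandardPointIsQPilot` HOLDS as soon as the total valuation of `ms` is `−3 = 1 − 2²`**: at label `2` the accumulated transport
carries the Θ-region `B_4` onto the q-region `B_1`, at label `1` it fixes `B_1`, at label `0` both sides are the convention `univ`.
[claim: Joshi2024ATS3, status: disputed] -/
theorem routeDictionary_standardPointIsQPilot (hsum : (ms.map fun m => padicValRat p (m.1 1)).sum = -3) :
    StandardPointIsQPilot (scalRegion p) (qDatum p) (routeDictionary p I hI ms) := fun j vQ => by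
  refine (routeDictionary_region_std p I hI ms j vQ).trans ?_
  by_cases hj : j = 0
  · subst hj
    rw [scalRegion_zero, scalRegion_zero]
    exact Set.image_univ_of_surjective (routeAut I hI ms 0 vQ).surjective
  · rw [scalRegion_qDatum p hj, scalRegion_Psi, if_neg hj]
    have h3 : (j : ℕ) < 3 := j.2
    have hne : (j : ℕ) ≠ 0 := fun h0 => hj (Fin.ext h0)
    by_cases h2 : (j : ℕ) = 2
    · obtain rfl : j = 2 := Fin.ext h2
      have h4 : jsq (2 : toyIndex.Label) = 4 := rfl
      rw [h4]
      refine (image_pBall_routeAut_two p I hI ms vQ 4).trans ?_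
      rw [hsum]
      norm_num
    · have h1 : (j : ℕ) = 1 := by omega
      refine (image_pBall_routeAut_of_ne_two p I hI ms h2 vQ (jsq j)).trans ?_
      unfold jsq
      rw [h1]
      norm_num

/-- **Y₂ (size form) `StandardPointHasQPilotVolume` HOLDS** then too (with equality, through (pq′)). [claim: Joshi2024ATS3, status: disputed] -/
theorem routeDictionary_standardPointHasQPilotVolume (hsum : (ms.map fun m => padicValRat p (m.1 1)).sum = -3) :
    StandardPointHasQPilotVolume (scalRegion p) (routeDictionary p I hI ms) (P := ismSetting p I hI) := fun j vQ => by
  rw [routeDictionary_standardPointIsQPilot p I hI ms hsum j vQ, ← ismSetting_qPinned p I hI j vQ]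
  exact le_rfl

/-- **NON-DEGENERACY** when the total valuation is `−3`: moves inhabited (the identity is in `I`), the data of base and standard point DIFFER
(regions `B_4 ≠ B_1` at label `2`), and the (Ind2) of the reading does NOT preserve log-volumes (some `m_i` has `v_p(m_i 1) ≠ 0`). [folklore] -/
theorem routeDictionary_nondegenerate (hsum : (ms.map fun m => padicValRat p (m.1 1)).sum = -3) :
    Nonempty (routeDictionary p I hI ms).Move ∧
      (routeDictionary p I hI ms).datum (routeDictionary p I hI ms).base ≠
        (routeDictionary p I hI ms).datum (routeDictionary p I hI ms).std ∧
      ¬ ((ismFull p I hI).toLatticeSituation.D (ismSetting p I hI).n).LogvolInvariant := by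
  refine ⟨⟨⟨LinearEquiv.refl ℚ ℚ, hI⟩⟩, fun h => ?_, fun hL => ?_⟩
  · have h0 : (routeDictionary p I hI ms).datum (routeDictionary p I hI ms).base = fun v _ => Psi p v :=
      routeDictionary_baseIsThetaPilot p I hI ms
    have h2 : scalRegion p ((routeDictionary p I hI ms).datum (routeDictionary p I hI ms).base) 2 () =
        scalRegion p ((routeDictionary p I hI ms).datum (routeDictionary p I hI ms).std) 2 () := by rw [h]
    rw [h0, scalRegion_Psi, if_neg (by decide), routeDictionary_standardPointIsQPilot p I hI ms hsum 2 (),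
      scalRegion_qDatum p (by decide)] at h2
    have h4 : jsq (2 : toyIndex.Label) = 4 := rfl
    have h5 := pBall_injective p 2 () h2
    omega
  · have hall : ∀ m ∈ ms, padicValRat p (m.1 1) = 0 := fun m _ => (logvolInvariant_iff p I hI).1 hL m.1 m.2
    have hzero : (ms.map fun m => padicValRat p (m.1 1)).sum = 0 :=
      List.sum_eq_zero fun x hx => by
        obtain ⟨m, hm, rfl⟩ := List.mem_map.1 hx
        exact hall m hm
    omega

/-- **THE ROUTE DICTIONARY'S PROPS, PACKAGED**: for every reading `I` and every list `ms ⊆ I` of total valuation `−3`, Y-14 ∧ all four X-01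
hypotheses ∧ `MovesAreInd` (by the D-09 route) ∧ `AnsatzWithinInd` ∧ Y₂ (both forms) HOLD, non-degenerately, and the X-01 glue returns S
(`pilotKummerIndRelated_of_strictMoves`, p430617). A model EXHIBITS satisfiability; located, not adjudicated. [claim: Joshi2024ATS3, status: disputed] -/
theorem routeDictionary_props (hsum : (ms.map fun m => padicValRat p (m.1 1)).sum = -3) :
    RealisedByStrictMoves (routeDictionary p I hI ms) (labelDatum toyIndex) (fun m => tailG m.1) (fun _ => id) ∧
      LocalIsosInInd (routeDictionary p I hI ms) (labelDatum toyIndex) (fun m => tailG m.1) ∧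
      BaseIsThetaPilot (routeDictionary p I hI ms) (P := ismSetting p I hI) ∧ MovesAreInd (routeDictionary p I hI ms) ∧
      DatumEquivariant (routeDictionary p I hI ms) ∧ StdReachable (routeDictionary p I hI ms) ∧
      AnsatzWithinInd (scalRegion p) (routeDictionary p I hI ms) (P := ismSetting p I hI) ∧
      StandardPointIsQPilot (scalRegion p) (qDatum p) (routeDictionary p I hI ms) ∧
      StandardPointHasQPilotVolume (scalRegion p) (routeDictionary p I hI ms) (P := ismSetting p I hI) ∧
      (Nonempty (routeDictionary p I hI ms).Move ∧
        (routeDictionary p I hI ms).datum (routeDictionary p I hI ms).base ≠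
          (routeDictionary p I hI ms).datum (routeDictionary p I hI ms).std ∧
        ¬ ((ismFull p I hI).toLatticeSituation.D (ismSetting p I hI).n).LogvolInvariant) ∧
      PilotKummerIndRelated (ismFull p I hI).toLatticeSituation (ismSetting p I hI) (scalRegion p) (qDatum p) :=
  ⟨routeDictionary_realisedByStrictMoves p I hI ms, routeDictionary_localIsosInInd p I hI ms, routeDictionary_baseIsThetaPilot p I hI ms,
    routeDictionary_movesAreInd p I hI ms, routeDictionary_datumEquivariant p I hI ms, routeDictionary_stdReachable p I hI ms,
    ansatzWithinInd_of_strictMoves (scalRegion p) (routeDictionary p I hI ms) (labelDatum toyIndex) (fun m => tailG m.1) (fun _ => id)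
      (routeDictionary_realisedByStrictMoves p I hI ms) (routeDictionary_localIsosInInd p I hI ms)
      (routeDictionary_baseIsThetaPilot p I hI ms) (routeDictionary_datumEquivariant p I hI ms) (routeDictionary_stdReachable p I hI ms),
    routeDictionary_standardPointIsQPilot p I hI ms hsum, routeDictionary_standardPointHasQPilotVolume p I hI ms hsum,
    routeDictionary_nondegenerate p I hI ms hsum,
    pilotKummerIndRelated_of_strictMoves (scalRegion p) (qDatum p) (routeDictionary p I hI ms) (labelDatum toyIndex) (fun m => tailG m.1)
      (fun _ => id) (routeDictionary_realisedByStrictMoves p I hI ms) (routeDictionary_localIsosInInd p I hI ms)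
      (routeDictionary_baseIsThetaPilot p I hI ms) (routeDictionary_datumEquivariant p I hI ms) (routeDictionary_stdReachable p I hI ms)
      (routeDictionary_standardPointIsQPilot p I hI ms hsum)⟩

omit hp in
/-- A list of valuations of elements of `I` is the list of valuations of a list of elements of `I`. [folklore] -/
theorem exists_list_of_forall_mem (l : List ℤ) (hl : ∀ y ∈ l, y ∈ (fun g : ℚ ≃ₗ[ℚ] ℚ => padicValRat p (g 1)) '' I) :
    ∃ ms : List {m : ℚ ≃ₗ[ℚ] ℚ // m ∈ I}, (ms.map fun m => padicValRat p (m.1 1)).sum = l.sum := by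
  induction l with
  | nil => exact ⟨[], rfl⟩
  | cons y l ih =>
      obtain ⟨ms, hms⟩ := ih fun z hz => hl z (List.mem_cons_of_mem _ hz)
      obtain ⟨g, hg, hgy⟩ := hl y (List.mem_cons.2 (Or.inl rfl))
      have hgy' : padicValRat p (g 1) = y := hgy
      refine ⟨⟨g, hg⟩ :: ms, ?_⟩
      show padicValRat p (g 1) + (ms.map fun m => padicValRat p (m.1 1)).sum = y + l.sum
      rw [hgy', hms]

omit hp in
/-- Every element of `M⁺(I)` is the total valuation of a list of elements of `I`. [folklore] -/
theorem exists_list_of_mem_closure {x : ℤ} (hx : x ∈ AddSubmonoid.closure ((fun g : ℚ ≃ₗ[ℚ] ℚ => padicValRat p (g 1)) '' I)) :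
    ∃ ms : List {m : ℚ ≃ₗ[ℚ] ℚ // m ∈ I}, (ms.map fun m => padicValRat p (m.1 1)).sum = x := by
  obtain ⟨l, hl, rfl⟩ := AddSubmonoid.exists_list_of_mem_closure hx
  exact exists_list_of_forall_mem p I l hl

end Sufficiency

/-! ## 4. THE CRITERION for row Y-14 -/

section Criterion

variable (p : ℕ) [hp : Fact p.Prime] (I : Set (ℚ ≃ₗ[ℚ] ℚ)) (hI : LinearEquiv.refl ℚ ℚ ∈ I)

/-- **Y-14 DECIDED over the free-Ism family.** Over the reading `Ism := I` (setting `ismSetting p I`, operator `scalRegion p`, q-datum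
`qDatum p`): SOME dictionary realised by §9.4 strict moves with (Ind)-local components (Y-14) satisfies the other three X-01 hypotheses and Y₂
**iff `−3 = 1 − 2²` lies in the SUBMONOID `M⁺(I)` of `ℤ` generated by `{v_p(g 1) : g ∈ I}`.** Compare E-t58's criterion p440522 for S itself:
`−3` in the SUBGROUP `G(I)`. [claim: Joshi2024ATS3, status: disputed] [claim: Mochizuki2012, status: disputed] -/
theorem strictMovesRoute_iff :
    (∃ (𝔇 : Dictionary (ismFull p I hI).toLatticeSituation) (𝔗 : TensorPacketDatum toyIndex)
        (G : 𝔇.Move → 𝔗.Arith → toyIndex.V → (ℚ ≃ₗ[ℚ] ℚ)) (z : 𝔇.Move → toyIndex.Label → 𝔗.Arith),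
        RealisedByStrictMoves 𝔇 𝔗 G z ∧ LocalIsosInInd 𝔇 𝔗 G ∧ BaseIsThetaPilot 𝔇 (P := ismSetting p I hI) ∧
          DatumEquivariant 𝔇 ∧ StdReachable 𝔇 ∧ StandardPointIsQPilot (scalRegion p) (qDatum p) 𝔇) ↔
      (-3 : ℤ) ∈ AddSubmonoid.closure ((fun g : ℚ ≃ₗ[ℚ] ℚ => padicValRat p (g 1)) '' I) := by
  constructor
  · rintro ⟨𝔇, 𝔗, G, z, hR, hG, hB, hE, hS, hQ⟩
    exact mem_closure_of_strictMovesRoute p I hI 𝔇 𝔗 G z hR hG hB hE hS hQ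
  · intro h
    obtain ⟨ms, hms⟩ := exists_list_of_mem_closure p I h
    exact ⟨routeDictionary p I hI ms, labelDatum toyIndex, fun m => tailG m.1, fun _ => id,
      routeDictionary_realisedByStrictMoves p I hI ms, routeDictionary_localIsosInInd p I hI ms,
      routeDictionary_baseIsThetaPilot p I hI ms, routeDictionary_datumEquivariant p I hI ms, routeDictionary_stdReachable p I hI ms,
      routeDictionary_standardPointIsQPilot p I hI ms hms⟩

/-- **COROLLARY (A1's non-isometric horn is NECESSARY): the Y-14 route implies ¬`LogvolInvariant`** — some element of Ism moves valuations
(E-t58's `logvolInvariant_iff`). [folklore] -/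
theorem strictMovesRoute_not_logvolInvariant (𝔇 : Dictionary (ismFull p I hI).toLatticeSituation) (𝔗 : TensorPacketDatum toyIndex)
    (G : 𝔇.Move → 𝔗.Arith → toyIndex.V → (ℚ ≃ₗ[ℚ] ℚ)) (z : 𝔇.Move → toyIndex.Label → 𝔗.Arith)
    (hR : RealisedByStrictMoves 𝔇 𝔗 G z) (hG : LocalIsosInInd 𝔇 𝔗 G) (hB : BaseIsThetaPilot 𝔇 (P := ismSetting p I hI))
    (hE : DatumEquivariant 𝔇) (hS : StdReachable 𝔇) (hQ : StandardPointIsQPilot (scalRegion p) (qDatum p) 𝔇) :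
    ¬ ((ismFull p I hI).toLatticeSituation.D (ismSetting p I hI).n).LogvolInvariant := fun hL =>
  isometric_no_route p I hI 𝔇 𝔗 G z ((logvolInvariant_iff p I hI).1 hL) hR hG hB hE hS hQ

/-- **COROLLARY: the Y-14 route implies S** (p430617's glue) — consistent with `M⁺(I) ≤ G(I)`. [claim: Joshi2024ATS3, status: disputed] -/
theorem pilotKummerIndRelated_of_mem_closure
    (h : (-3 : ℤ) ∈ AddSubmonoid.closure ((fun g : ℚ ≃ₗ[ℚ] ℚ => padicValRat p (g 1)) '' I)) :
    PilotKummerIndRelated (ismFull p I hI).toLatticeSituation (ismSetting p I hI) (scalRegion p) (qDatum p) := by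
  obtain ⟨ms, hms⟩ := exists_list_of_mem_closure p I h
  exact (routeDictionary_props p I hI ms hms).2.2.2.2.2.2.2.2.2.2

end Criterion

end Summit.ABC.IUTFork.Joshi

end
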